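import Summits.ValiantsHypothesis.ValiantsHypothesis.Theorems.KPlusLogSqLawTropicalBToeplitzBlockSwap

/-!
# Route `KPlusLogSqLaw`, crux `TropicalB` — Toeplitz sector: unique optima and dominant terms are PERSYMMETRIC

HONEST FRAMING.  Helper toward the registered stubs `stub_tropThin` / `stub_tropFat` of
`Cruxes/TropicalB/Lines/birth.lean` (crux `Summit.ValiantsHypothesis.ValiantsHypothesis.Theses.KPlusLogSqLaw.TropicalB`,
ledger item `stmt-ValiantsHypothesis-19771`, route `KPlusLogSqLaw`; cell `pub-symmetroid`, seat `val-sym-trop-p3`,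
2026-08-26).  A structural constraint on every candidate of the cell's Conjecture T and on every dominant term of a
Toeplitz design, complementary to block-swap rigidity (`…ToeplitzBlockSwap`); nothing here bounds `Φ`, `TropicalB`,
`KPlusLogSqLaw`, `MatrixDescartes` or anything about `VP ≠ VNP`.

THE SYMMETRY.  The anti-transpose `(a, b) ↦ (m−1−b, m−1−a)` fixes the difference `a − b`, so it maps a Toeplitz cost
to itself; on permutations it is `σ ↦ σ° := rev ∘ σ⁻¹ ∘ rev`, and the displacement sequence of `σ°` is that of `σ`
re-indexed along `β = rev ∘ σ` (`σ° (β c) − β c = σ c − c`).  Hence: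
* `toeplitz_opt_persymmetric` — a permutation that is the UNIQUE maximiser of a linear Toeplitz instance among admissible
  permutations satisfies `rev ∘ τ⁻¹ ∘ rev = τ`, i.e. `τ⁻¹ (rev x) = rev (τ x)` (`toeplitz_opt_symm_rev`): `τ ∘ rev` is an
  involution.  Rotations and block rotations are persymmetric; so is every member of the certified extremal chains.
* `toeplitz_dominant_persymmetric` — the same for a DOMINANT term `(σ, μ)` of a Toeplitz design, together with the class
  symmetry `μ c = μ (rev (σ c))` (transport lemma `toeplitz_dominant_eq_of_transport`, `…TropicalBToeplitz`).

References: folklore (persymmetry of Toeplitz matrices); `toeplitz_dominant_eq_of_transport` (val-sym-trop-p2, p427725).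
-/

set_option linter.dupNamespace false
set_option autoImplicit false

namespace Summit.ValiantsHypothesis.ValiantsHypothesis.Theorems.KPlusLogSqLaw

open Summit.ValiantsHypothesis.ValiantsHypothesis.Theorems.MatrixDescartes.Negative
open scoped BigOperators
open Finset

section Persymmetric

variable {m K : ℕ}

/-- The displacement sequence of `σ° = rev ∘ σ⁻¹ ∘ rev` is that of `σ` re-indexed by `β = rev ∘ σ`:
`σ° (β c) − β c = σ c − c`. [folklore] -/
theorem displacement_revConj (σ : Equiv.Perm (Fin m)) (c : Fin m) :
    ((((Fin.revPerm.trans σ.symm).trans Fin.revPerm) ((σ.trans Fin.revPerm) c) : Fin m) : ℤ) -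
        (((σ.trans Fin.revPerm) c : Fin m) : ℤ) = ((σ c : Fin m) : ℤ) - (c : ℤ) := by
  simp only [Equiv.trans_apply, Fin.revPerm_apply, Fin.rev_rev, Equiv.symm_apply_apply]
  have h1 := c.isLt
  have h2 := (σ c).isLt
  rw [Fin.val_rev, Fin.val_rev]
  omega

/-- **Unique optima of linear Toeplitz instances are persymmetric**: `rev ∘ τ⁻¹ ∘ rev = τ`.  The conjugate has the same
displacement multiset (`displacement_revConj`), hence the same weight and admissibility; uniqueness does the rest.
[folklore] -/
theorem toeplitz_opt_persymmetric (ψ α : ℤ → ℤ) (P : ℤ → Prop) (θ : ℤ) (τ : Equiv.Perm (Fin m))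
    (hτP : ∀ b, P ((τ b : ℤ) - b))
    (huniq : ∀ σ : Equiv.Perm (Fin m), σ ≠ τ → (∀ b, P ((σ b : ℤ) - b)) →
      ∑ b, (θ * ψ ((σ b : ℤ) - b) + α ((σ b : ℤ) - b)) < ∑ b, (θ * ψ ((τ b : ℤ) - b) + α ((τ b : ℤ) - b))) :
    (Fin.revPerm.trans τ.symm).trans Fin.revPerm = τ := by
  set τ' : Equiv.Perm (Fin m) := (Fin.revPerm.trans τ.symm).trans Fin.revPerm with hτ'
  set β : Equiv.Perm (Fin m) := τ.trans Fin.revPerm with hβ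
  have hdisp : ∀ b : Fin m, ((τ' b : Fin m) : ℤ) - b = ((τ (β.symm b) : Fin m) : ℤ) - (β.symm b : Fin m) := by
    intro b
    have := displacement_revConj τ (β.symm b)
    rw [← hτ', ← hβ, Equiv.apply_symm_apply] at this
    exact this
  by_contra hne
  have hP' : ∀ b, P ((τ' b : ℤ) - b) := fun b => by rw [hdisp]; exact hτP _
  have hlt := huniq τ' hne hP'
  have hW : ∑ b, (θ * ψ ((τ' b : ℤ) - b) + α ((τ' b : ℤ) - b)) =
      ∑ b, (θ * ψ ((τ b : ℤ) - b) + α ((τ b : ℤ) - b)) := by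
    rw [← Equiv.sum_comp β.symm (fun c => θ * ψ ((τ c : ℤ) - c) + α ((τ c : ℤ) - c))]
    exact sum_congr rfl fun b _ => by rw [hdisp]
  rw [hW] at hlt
  exact lt_irrefl _ hlt

/-- Pointwise form: for a unique optimum, `τ⁻¹ (rev x) = rev (τ x)` — `τ ∘ rev` is an involution. [folklore] -/
theorem toeplitz_opt_symm_rev (ψ α : ℤ → ℤ) (P : ℤ → Prop) (θ : ℤ) (τ : Equiv.Perm (Fin m))
    (hτP : ∀ b, P ((τ b : ℤ) - b))
    (huniq : ∀ σ : Equiv.Perm (Fin m), σ ≠ τ → (∀ b, P ((σ b : ℤ) - b)) →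
      ∑ b, (θ * ψ ((σ b : ℤ) - b) + α ((σ b : ℤ) - b)) < ∑ b, (θ * ψ ((τ b : ℤ) - b) + α ((τ b : ℤ) - b)))
    (x : Fin m) : τ.symm (Fin.rev x) = Fin.rev (τ x) := by
  have h := toeplitz_opt_persymmetric ψ α P θ τ hτP huniq
  have hx := congrArg (fun e : Equiv.Perm (Fin m) => e x) h
  simp only [Equiv.trans_apply, Fin.revPerm_apply] at hx
  -- `rev (τ⁻¹ (rev x)) = τ x`
  rw [← hx, Fin.rev_rev]

/-- **Dominant terms of Toeplitz designs are persymmetric**, class pattern included: for a dominant term `(σ, μ)` of a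
design with `v a b l = f (a − b) l`, `ε a b l = g (a − b) l`, one has `rev ∘ σ⁻¹ ∘ rev = σ` and `μ c = μ (rev (σ c))` for
every column `c` (transport along `β = rev ∘ σ`, `toeplitz_dominant_eq_of_transport`). [folklore] -/
theorem toeplitz_dominant_persymmetric (d : Fin K → ℕ) (f g : ℤ → Fin K → ℤ) (θ : ℤ)
    (σ : Equiv.Perm (Fin m)) (μ : Fin m → Fin K)
    (hp : IsDominant d (fun a b l => f ((a : ℤ) - b) l) (fun a b l => g ((a : ℤ) - b) l) θ (σ, μ)) :
    (Fin.revPerm.trans σ.symm).trans Fin.revPerm = σ ∧ ∀ c : Fin m, μ c = μ (Fin.rev (σ c)) := by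
  have hT := toeplitz_dominant_eq_of_transport d f g θ σ ((Fin.revPerm.trans σ.symm).trans Fin.revPerm)
    (σ.trans Fin.revPerm) μ (fun c => displacement_revConj σ c) hp
  refine ⟨congrArg Prod.fst hT, fun c => ?_⟩
  have h2 := congrFun (congrArg Prod.snd hT) ((σ.trans Fin.revPerm) c)
  simp only [Equiv.symm_apply_apply] at h2
  rw [h2]
  simp [Equiv.trans_apply, Fin.revPerm_apply]

end Persymmetric

end Summit.ValiantsHypothesis.ValiantsHypothesis.Theorems.KPlusLogSqLaw
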